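import Literature.NumberTheory.Transcendental.TorusZeroEstimateProofs
import Literature.NumberTheory.Transcendental.TorusSaturation
import Mathlib.LinearAlgebra.Dimension.StrongRankCondition
import Mathlib.RingTheory.MvPolynomial.Homogeneous
import HarnessLib

/-!
# Characters, binomials and homogenisation on the torus `(ℂˣ)ⁿ`

Topic: `Literature/NumberTheory/Transcendental` (support for `Philippon1986_zeroEstimate_torus_holds`).
Elementary facts about `T = (ℂˣ)ⁿ` (`Torus n`), its characters `χ_a` (`Torus.char`) and subtori
`H_A` (`Torus.subtorus`):

* `aevalAt_monomial`, `aevalAt_eq_sum` — a polynomial evaluated at a torus point (the tree's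
  `Torus.aevalAt`; `aevalAt_eq_aeval` is the bridge to Mathlib's `MvPolynomial.aeval`) is a
  linear combination of character values `χ_m(g)`, `m ∈ ℕⁿ`;
* **`exists_binomial_separating`** — two distinct cosets `uH_A ≠ wH_A` are separated by a binomial
  `X^{a⁺} - χ_a(u) X^{a⁻}` (`a ∈ A` with `χ_a(u⁻¹w) ≠ 1`) vanishing on `uH_A` and nowhere zero on
  `wH_A`; hence cosets of subtori are cut out inside `T` by the polynomials vanishing on them
  (`inv_mul_mem_subtorus_of_forall_aevalAt_eq_zero`) — the torus case of "algebraic subgroups and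
  their translates are closed" (Nesterenko–Philippon (eds.), LNM 1752, Ch. 11 §2.1 Example);
* `isHomogeneous_homogenization`, `aeval_cons_smul_homogenization` — the homogenisation
  `q ↦ Σ_m c_m X_0^{D-|m|} X^m` of a polynomial of degree `≤ D` is a form of degree `D` with
  `q^h(λ, λy) = λ^D q(y)` (cones over subsets of `T`);
* **`exists_transversal_coordinates`** — for `A ≤ ℤ^d` there is a set `U` of at least
  `d - rank A` coordinates with `ℤ^U ∩ A = 0` (a maximal such `U`: for each `j ∉ U` some member of
  `A` supported on `U ∪ {j}` has non-zero `j`-th coordinate, and these are linearly independent).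

## References

* Yu. V. Nesterenko, P. Philippon (eds.), *Introduction to Algebraic Independence Theory*,
  LNM 1752 (2001), Ch. 11 (D. Roy), §2.1, Example (p. 199). [NesterenkoPhilippon2001]
-/

noncomputable section

open MvPolynomial

namespace Literature.NumberTheory.Transcendental

open Torus

variable {n : ℕ}

/-! ## Characters and monomials -/

/-- Bridge to Mathlib's `aeval`: `aevalAt P g = aeval (g_i)_i P`. [folklore] -/
theorem aevalAt_eq_aeval (P : MvPolynomial (Fin n) ℂ) (g : Torus n) :
    aevalAt P g = MvPolynomial.aeval (fun i => ((g i : ℂˣ) : ℂ)) P := rfl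

/-- The value of the character `χ_m`, `m ∈ ℕⁿ`, is the monomial `∏ g_i^{m_i}`. [folklore] -/
theorem coe_char_natCast (m : Fin n →₀ ℕ) (g : Torus n) :
    ((char (fun i => (m i : ℤ)) g : ℂˣ) : ℂ) = ∏ i, ((g i : ℂˣ) : ℂ) ^ (m i) := by
  rw [char_apply, Units.coe_prod]
  refine Finset.prod_congr rfl fun i _ => ?_
  rw [zpow_natCast, Units.val_pow_eq_pow_val]

/-- Evaluating a monomial at a torus point: `(c X^m)(g) = c · χ_m(g)`. [folklore] -/
theorem aevalAt_monomial (m : Fin n →₀ ℕ) (c : ℂ) (g : Torus n) :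
    aevalAt (monomial m c) g = c * ((char (fun i => (m i : ℤ)) g : ℂˣ) : ℂ) := by
  rw [aevalAt_eq_aeval, aeval_monomial, Finsupp.prod_fintype _ _ (fun i => by rw [pow_zero]),
    coe_char_natCast, Algebra.algebraMap_eq_smul_one, smul_mul_assoc, one_mul, smul_eq_mul]

/-- Evaluating at `g` as a sum over the support: `P(g) = Σ_m c_m χ_m(g)`. [folklore] -/
theorem aevalAt_eq_sum (f : MvPolynomial (Fin n) ℂ) (g : Torus n) :
    aevalAt f g = ∑ m ∈ f.support, coeff m f * ((char (fun i => (m i : ℤ)) g : ℂˣ) : ℂ) := by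
  rw [aevalAt_eq_aeval]
  conv_lhs => rw [f.as_sum, map_sum]
  exact Finset.sum_congr rfl fun m _ => (aevalAt_eq_aeval _ g).symm.trans (aevalAt_monomial m _ g)

/-! ## Binomials separating cosets of subtori -/

/-- Positive and negative parts of an integer vector recombine: `χ_a · χ_{a⁻} = χ_{a⁺}`.
[folklore] -/
theorem char_mul_char_negPart (a : Fin n → ℤ) (g : Torus n) :
    char a g * char (fun i => (((-a i).toNat : ℕ) : ℤ)) g = char (fun i => (((a i).toNat : ℕ) : ℤ)) g := by
  have heq : (a + fun i => (((-a i).toNat : ℕ) : ℤ)) = fun i => (((a i).toNat : ℕ) : ℤ) := by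
    funext i
    simp only [Pi.add_apply]
    have := Int.toNat_sub_toNat_neg (a i)
    omega
  rw [← char_add, heq]

/-- **A binomial separating two cosets of a subtorus**: if `u⁻¹ w ∉ H_A` there is a polynomial
vanishing on `u H_A` and nowhere zero on `w H_A` (namely `X^{a⁺} - χ_a(u) X^{a⁻}` for `a ∈ A` with
`χ_a(u⁻¹ w) ≠ 1`). [folklore] -/
theorem exists_binomial_separating (A : AddSubgroup (Fin n → ℤ)) {u w : Torus n}
    (h : u⁻¹ * w ∉ subtorus A) :
    ∃ b : MvPolynomial (Fin n) ℂ, (∀ h ∈ subtorus A, aevalAt b (u * h) = 0) ∧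
      (∀ h ∈ subtorus A, aevalAt b (w * h) ≠ 0) := by
  classical
  simp_rw [aevalAt_eq_aeval]
  rw [mem_subtorus] at h
  push Not at h
  obtain ⟨a, haA, hau⟩ := h
  -- exponent vectors `a⁺`, `a⁻`
  let ap : Fin n →₀ ℕ := Finsupp.equivFunOnFinite.symm fun i => (a i).toNat
  let am : Fin n →₀ ℕ := Finsupp.equivFunOnFinite.symm fun i => (-a i).toNat
  have hap : (fun i => (ap i : ℤ)) = fun i => (((a i).toNat : ℕ) : ℤ) := by
    funext i; simp [ap]
  have ham : (fun i => (am i : ℤ)) = fun i => (((-a i).toNat : ℕ) : ℤ) := by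
    funext i; simp [am]
  set c : ℂ := ((char a u : ℂˣ) : ℂ) with hc
  refine ⟨monomial ap 1 - C c * monomial am 1, fun h hh => ?_, fun h hh => ?_⟩
  · rw [map_sub, map_mul, aeval_C, Algebra.algebraMap_self_apply, ← aevalAt_eq_aeval,
      ← aevalAt_eq_aeval, aevalAt_monomial, aevalAt_monomial, one_mul, one_mul, hap, ham,
      ← char_mul_char_negPart a, map_mul (char a), (mem_subtorus.mp hh) a haA, mul_one]
    simp [hc]
  · rw [map_sub, map_mul, aeval_C, Algebra.algebraMap_self_apply, ← aevalAt_eq_aeval,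
      ← aevalAt_eq_aeval, aevalAt_monomial, aevalAt_monomial, one_mul, one_mul, hap, ham,
      ← char_mul_char_negPart a, map_mul (char a), (mem_subtorus.mp hh) a haA, mul_one,
      Units.val_mul]
    have hne : ((char a w : ℂˣ) : ℂ) ≠ c := by
      intro heq
      apply hau
      have : char a w = char a u := Units.val_injective heq
      rw [map_mul, map_inv, this, inv_mul_cancel]
    intro h0
    apply hne
    have hunit : ((char (fun i => (((-a i).toNat : ℕ) : ℤ)) (w * h) : ℂˣ) : ℂ) ≠ 0 := Units.ne_zero _
    have : (((char a w : ℂˣ) : ℂ) - c) * ((char (fun i => (((-a i).toNat : ℕ) : ℤ)) (w * h) : ℂˣ) : ℂ) = 0 := by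
      rw [sub_mul]; simpa [MvPolynomial.algebraMap_eq] using h0
    exact sub_eq_zero.mp ((mul_eq_zero.mp this).resolve_right hunit)

/-- **Cosets of subtori are cut out in `T` by the polynomials vanishing on them**: if every
polynomial vanishing on `u H_A` vanishes at `w`, then `w ∈ u H_A`. [cite: NesterenkoPhilippon2001, Ch. 11 §2.1 Example p. 199] -/
theorem inv_mul_mem_subtorus_of_forall_aevalAt_eq_zero (A : AddSubgroup (Fin n → ℤ))
    {u w : Torus n}
    (h : ∀ b : MvPolynomial (Fin n) ℂ, (∀ h ∈ subtorus A, aevalAt b (u * h) = 0) → aevalAt b w = 0) :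
    u⁻¹ * w ∈ subtorus A := by
  by_contra hnot
  obtain ⟨b, hb, hb'⟩ := exists_binomial_separating A hnot
  have := hb' 1 (Subgroup.one_mem _)
  rw [mul_one] at this
  exact this (h b hb)

/-! ## Homogenisation -/

/-- The degree of a `Finsupp.cons` exponent vector. [folklore] -/
theorem degree_cons (e : ℕ) (m : Fin n →₀ ℕ) : (Finsupp.cons e m).degree = e + m.degree := by
  rw [Finsupp.degree_eq_sum, Finsupp.degree_eq_sum, Fin.sum_univ_succ, Finsupp.cons_zero]
  simp only [Finsupp.cons_succ]

/-- **The homogenisation of a polynomial of degree `≤ D` is a form of degree `D`.** [folklore] -/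
theorem isHomogeneous_homogenization {q : MvPolynomial (Fin n) ℂ} {D : ℕ} (hq : q.totalDegree ≤ D) :
    MvPolynomial.IsHomogeneous
      (∑ m ∈ q.support, monomial (Finsupp.cons (D - m.degree) m) (coeff m q) :
        MvPolynomial (Fin (n + 1)) ℂ) D := by
  refine MvPolynomial.IsHomogeneous.sum _ _ _ fun m hm => isHomogeneous_monomial _ ?_
  rw [degree_cons]
  have : m.degree ≤ D := (le_totalDegree hm).trans hq
  omega

/-- **Evaluation of the homogenisation on a cone**: `q^h(λ, λ y) = λ^D q(y)` for `deg q ≤ D`.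
[folklore] -/
theorem aeval_cons_smul_homogenization {q : MvPolynomial (Fin n) ℂ} {D : ℕ} (hq : q.totalDegree ≤ D)
    (lam : ℂ) (y : Fin n → ℂ) :
    MvPolynomial.aeval (Fin.cons lam (lam • y) : Fin (n + 1) → ℂ)
      (∑ m ∈ q.support, monomial (Finsupp.cons (D - m.degree) m) (coeff m q) :
        MvPolynomial (Fin (n + 1)) ℂ) = lam ^ D * MvPolynomial.aeval y q := by
  rw [map_sum]
  conv_rhs => rw [q.as_sum, map_sum, Finset.mul_sum]
  refine Finset.sum_congr rfl fun m hm => ?_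
  have hmD : m.degree ≤ D := (le_totalDegree hm).trans hq
  rw [aeval_monomial, aeval_monomial, Finsupp.prod_fintype _ _ (fun i => by rw [pow_zero]),
    Finsupp.prod_fintype _ _ (fun i => by rw [pow_zero]), Fin.prod_univ_succ, Fin.cons_zero,
    Finsupp.cons_zero]
  simp only [Fin.cons_succ, Finsupp.cons_succ, Pi.smul_apply, smul_eq_mul, mul_pow,
    Finset.prod_mul_distrib, Finset.prod_pow_eq_pow_sum]
  rw [← Finsupp.degree_eq_sum]
  have : lam ^ (D - m.degree) * lam ^ m.degree = lam ^ D := by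
    rw [← pow_add, Nat.sub_add_cancel hmD]
  calc (algebraMap ℂ ℂ) (coeff m q) * (lam ^ (D - m.degree) * (lam ^ m.degree * ∏ i, y i ^ m i))
      = lam ^ (D - m.degree) * lam ^ m.degree * ((algebraMap ℂ ℂ) (coeff m q) * ∏ i, y i ^ m i) := by
        ring
    _ = lam ^ D * ((algebraMap ℂ ℂ) (coeff m q) * ∏ i, y i ^ m i) := by rw [this]

/-! ## Transversal coordinates -/

/-- **Transversal coordinates**: for a subgroup `A ≤ ℤ^d` there is a set `U` of coordinates with
`|U| + rank A ≥ d` such that no non-zero member of `A` is supported on `U`. [folklore] -/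
theorem exists_transversal_coordinates {d : ℕ} (A : AddSubgroup (Fin d → ℤ)) :
    ∃ U : Finset (Fin d), d ≤ U.card + Module.finrank ℤ (AddSubgroup.toIntSubmodule A) ∧
      ∀ a ∈ A, (∀ i, i ∉ U → a i = 0) → a = 0 := by
  classical
  -- a maximal `U` with `ℤ^U ∩ A = 0`
  let good : Finset (Fin d) → Prop := fun U => ∀ a ∈ A, (∀ i, i ∉ U → a i = 0) → a = 0
  have hgood_empty : good ∅ := fun a _ ha => funext fun i => ha i (Finset.notMem_empty i)
  obtain ⟨U, hUmax⟩ := Finset.exists_maximal (s := Finset.univ.powerset.filter good)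
    ⟨∅, by rw [Finset.mem_filter]; exact ⟨Finset.empty_mem_powerset _, hgood_empty⟩⟩
  have hU : U ∈ Finset.univ.powerset.filter good := hUmax.1
  rw [Finset.mem_filter] at hU
  refine ⟨U, ?_, hU.2⟩
  -- for `j ∉ U` pick `v_j ∈ A` supported on `U ∪ {j}` with `v_j j ≠ 0`
  have hv : ∀ j : Fin d, j ∉ U → ∃ v ∈ A, (∀ i, i ∉ insert j U → v i = 0) ∧ v j ≠ 0 := by
    intro j hj
    by_contra hcon
    push Not at hcon
    have hgood : good (insert j U) := by
      intro a ha hsupp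
      have haj : a j = 0 := hcon a ha hsupp
      exact hU.2 a ha fun i hi => if hij : i = j then hij ▸ haj
        else hsupp i (by rw [Finset.mem_insert]; push Not; exact ⟨hij, hi⟩)
    have := hUmax.2 (y := insert j U)
      (by show insert j U ∈ Finset.univ.powerset.filter good
          rw [Finset.mem_filter]; exact ⟨by simp, hgood⟩)
      (Finset.subset_insert j U)
    exact hj (this (Finset.mem_insert_self j U))
  choose! v hvA hvsupp hvj using hv
  -- the `v_j`, `j ∉ U`, are linearly independent members of `A`
  let ι := {j : Fin d // j ∉ U}
  let w : ι → AddSubgroup.toIntSubmodule A := fun j => ⟨v j.1, hvA j.1 j.2⟩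
  have hli : LinearIndependent ℤ w := by
    rw [Fintype.linearIndependent_iff]
    intro c hc j
    have hsum : ∀ i : Fin d, (∑ k : ι, c k • v k.1) i = 0 := by
      intro i
      have := congrArg (fun x : AddSubgroup.toIntSubmodule A => (x : Fin d → ℤ) i) hc
      simpa [w, Finset.sum_apply, Submodule.coe_sum] using this
    have := hsum j.1
    rw [Finset.sum_apply, Finset.sum_eq_single j] at this
    · simp only [Pi.smul_apply, smul_eq_mul] at this
      exact (mul_eq_zero.mp this).resolve_right (hvj j.1 j.2)
    · intro k _ hkj
      simp only [Pi.smul_apply, smul_eq_mul]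
      rw [hvsupp k.1 k.2 j.1, mul_zero]
      rw [Finset.mem_insert]
      push Not
      exact ⟨fun h => hkj (Subtype.ext h.symm), j.2⟩
    · intro h; exact absurd (Finset.mem_univ j) h
  have hcard := hli.fintype_card_le_finrank
  have hι : Fintype.card ι = d - U.card := by
    rw [Fintype.card_subtype_compl, Fintype.card_fin]
    simp
  rw [hι] at hcard
  have := U.card_le_univ
  rw [Fintype.card_fin] at this
  omega

end Literature.NumberTheory.Transcendental

end
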